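import Summits.Schanuel.Schanuel.Theses.DiophantineDichotomy
import Summits.Schanuel.Schanuel.Theorems.DiophantineDichotomyApproximationPropertyDefs
import Literature.NumberTheory.Transcendental.NesterenkoEliminationFacts2Proofs
import Literature.NumberTheory.Transcendental.PhilipponCriterionPrincipal
import Literature.NumberTheory.Transcendental.PhilipponCriterionHomogenization
import Literature.NumberTheory.Transcendental.NesterenkoUResultantHeight
import Literature.NumberTheory.Transcendental.RoySmallValueFactors
import Literature.RingTheory.MvPolynomial.HomogeneousHilbertFunction
import Literature.NumberTheory.DiophantineApproximation.IntegerPolynomialSmallValue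
import Mathlib.Algebra.Polynomial.Homogenize
import HarnessLib

/-!
# Stub `stub_cycleAPI_one` of line `orbit-interpolation-determinant` (crux `ApproximationProperty`, stmt-Schanuel-6117)

Route `DiophantineDichotomy` (sub-problem `Schanuel/Schanuel`), crux
`Summit.Schanuel.Schanuel.Theses.DiophantineDichotomy.ApproximationProperty`, line
`orbit-interpolation-determinant`, registered stub `stub_cycleAPI_one : CycleAPIAt 1` — the
0-cycle approximation property WITH interpolation control in dimension `t = 1`, in Nesterenko's
elimination language (`Rx`, `ideg`, `iheight`, `iabs`, `IsUnmixedOfRank` of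
`Literature.NumberTheory.Transcendental.Nesterenko`).

In dimension `1` this is **Dirichlet's box principle**: for `ω ∈ ℂ` and
`Y ≥ Δ ≥ c(ω) = 50 (4 + |ω|)`, Bugeaud's Lemma 8.1 (`exists_int_poly_small_value`) gives a
non-zero `P ∈ ℤ[X]` of degree `d ≤ n = ⌊Δ⌋`, naive height `≤ e^{Y}` and
`|P(ω)| ≤ e^{-0.455 n Y}`; `P` is not constant. Its
homogenisation `E = x₀^d P(x₁/x₀) ∈ ℚ[x₀, x₁]` (Mathlib's `Polynomial.homogenize`, variables
swapped) generates a homogeneous ideal `I = (E)`, unmixed of rank `1`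
(`PhilipponMain.isUnmixedOfRank_span_singleton`), with `deg I = d`, `h(I) ≤ h(E) + d ≤ Y + d`,
`|I(1, ω)| ≤ ‖E‖_{(1,ω)} e^{2d} ≤ |P(ω)| e^{2d}` (LNM 1752 Ch. 3 Prop. 4.8,
`NesterenkoPhilippon2001_ch3_prop_4_8_holds`; `h(E) ≤ log |E|` for integer coefficients,
`height_map_le_log_maxNorm`). The accuracy required is OUTPUT-dependent but the output never
exceeds the budgets, so `0.455 n Y − 2d ≥ (Δ h(I) + Y deg I)/c`. Interpolation clause: an
associated prime of `(E)` is `(R)` for a prime factor `R` of `E` (colon ideals of principal ideals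
in the factorial ring `ℚ[x₀, x₁]`), `R` is a form (`Roy2013.isHomogeneous_of_dvd`) of degree
`r ≤ d ≤ ⌊cΔ⌋`, `deg (R) = r` (Prop. 4.8), and the Hilbert function of `(R)` is
`dim (R)_{t+r} = dim ℚ[x₀,x₁]_t = t + 1` (hypersurface section of `(0)` by the non-zero-divisor
`R`, `finrank_idealDegree_sup_span_add_eq`), while `dim ℚ[x₀,x₁]_δ = δ + 1`.

Proofs only: no new definitions, nothing asserted beyond the registered stub and its private
lemmas. Sources: Bugeaud 2004 Lemma 8.1; Nesterenko–Philippon (eds.), LNM 1752 (2001), Ch. 3 §4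
Prop. 4.8; Philippon, LNM 1752 Ch. 4 §4 (AP1 with `d' = 0`, `n = 1`).
-/

set_option linter.dupNamespace false

noncomputable section

namespace Summit.Schanuel.Schanuel.Cruxes.ApproximationProperty.OrbitInterpolationDeterminant

open Literature.NumberTheory.Transcendental.Nesterenko MvPolynomial Module
open Literature.NumberTheory.Transcendental (PhilipponMain.isUnmixedOfRank_span_singleton
  PhilipponMain.colon_span_singleton_eq PhilipponMain.cons_one_ne_zero
  PhilipponMain.one_le_norm_cons_one Roy2013.isHomogeneous_of_dvd)
open scoped BigOperators NNReal

namespace CycleAPIOne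

/-! ## Norms of coefficients -/

/-- If every coefficient of `P` has modulus at most `B ≥ 0` then `|P| ≤ B`. [folklore] -/
theorem maxNorm_le_of_forall_le {σ K : Type*} [NormedField K] (P : MvPolynomial σ K) {B : ℝ}
    (hB : 0 ≤ B) (h : ∀ γ, ‖P.coeff γ‖ ≤ B) : maxNorm P ≤ B := by
  have key : (P.support.sup fun γ => ‖P.coeff γ‖₊ : ℝ≥0) ≤ Real.toNNReal B := by
    refine Finset.sup_le fun γ _ => ?_
    rw [← NNReal.coe_le_coe, coe_nnnorm, Real.coe_toNNReal B hB]
    exact h γ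
  have key' := NNReal.coe_le_coe.mpr key
  rwa [Real.coe_toNNReal B hB] at key'

/-! ## Homogenisation of an integer polynomial as a binary form -/

/-- **Homogenisation.** For a non-zero `P ∈ ℤ[X]` with coefficients of modulus `≤ H` there is a
non-zero binary form `E ∈ ℚ[x₀, x₁]` of degree `deg P` with `E(1, ξ) = P(ξ)`, `1 ≤ |E| ≤ H` and
`h(E) ≤ log |E|` (`E = x₀^{deg P} P(x₁/x₀)` has the integer coefficients of `P`). [folklore] -/
theorem exists_binary_form (P : Polynomial ℤ) (hP : P ≠ 0) {H : ℝ}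
    (hH : ∀ i, (|P.coeff i| : ℝ) ≤ H) :
    ∃ E : Rx 1, E ≠ 0 ∧ E.IsHomogeneous P.natDegree ∧
      (∀ ω : Fin 1 → ℂ,
        aeval (Fin.cons 1 ω : Fin (1 + 1) → ℂ) E = (Polynomial.aeval (ω 0) P : ℂ)) ∧
      1 ≤ maxNorm E ∧ maxNorm E ≤ H ∧ height E ≤ Real.log (maxNorm E) := by
  classical
  have hH0 : 0 ≤ H := le_trans (by positivity) (hH 0)
  set Z : MvPolynomial (Fin (1 + 1)) ℤ := rename Fin.rev (P.homogenize P.natDegree) with hZ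
  have hZ0 : Z ≠ 0 := by
    intro h
    apply hP
    have h1 : P.homogenize P.natDegree = 0 :=
      rename_injective _ Fin.rev_injective (by rw [← hZ, h, map_zero])
    exact Polynomial.eq_zero_of_homogenize_eq_zero le_rfl h1
  have hinj : Function.Injective (MvPolynomial.map (σ := Fin (1 + 1)) (Int.castRingHom ℚ)) :=
    map_injective _ (RingHom.injective_int _)
  refine ⟨MvPolynomial.map (Int.castRingHom ℚ) Z, ?_, ?_, ?_, ?_, ?_, ?_⟩
  · exact (map_ne_zero_iff _ hinj).mpr hZ0
  · exact ((Polynomial.isHomogeneous_homogenize P).rename_isHomogeneous).map _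
  · intro ω
    have h1 : ((Fin.cons 1 ω : Fin (1 + 1) → ℂ) ∘ Fin.rev) 1 = 1 := rfl
    rw [← algebraMap_int_eq, aeval_map_algebraMap, hZ, aeval_rename,
      Polynomial.aeval_homogenize_of_eq_one le_rfl _ h1]
    rfl
  · -- `1 ≤ |E|`: some coefficient is a non-zero integer
    obtain ⟨γ, hγ⟩ := MvPolynomial.ne_zero_iff.mp ((map_ne_zero_iff _ hinj).mpr hZ0)
    refine le_trans ?_ (norm_coeff_le_maxNorm _ γ)
    rw [coeff_map, eq_intCast] at hγ ⊢
    have hz : coeff γ Z ≠ 0 := fun h => hγ (by rw [h, Int.cast_zero])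
    rw [Int.norm_cast_rat, Int.norm_eq_abs]
    exact_mod_cast Int.one_le_abs hz
  · -- `|E| ≤ H`
    refine maxNorm_le_of_forall_le _ hH0 fun γ => ?_
    rw [coeff_map, eq_intCast, Int.norm_cast_rat, Int.norm_eq_abs]
    by_cases hz : coeff γ Z = 0
    · rw [hz, Int.cast_zero, abs_zero]
      exact hH0
    · obtain ⟨u, hu, -⟩ := coeff_rename_ne_zero _ _ _ hz
      have hcoeff : coeff γ Z = (P.homogenize P.natDegree).coeff u := by
        rw [hZ, ← hu, coeff_rename_mapDomain _ Fin.rev_injective]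
      rw [hcoeff, Polynomial.coeff_homogenize]
      split_ifs
      · exact hH (u 0)
      · rw [Int.cast_zero, abs_zero]
        exact hH0
  · exact height_map_le_log_maxNorm Z hZ0

/-- A non-zero form of positive degree is not a unit of `ℚ[x̲]`. [folklore] -/
theorem not_isUnit_of_isHomogeneous {σ : Type*} {E : MvPolynomial σ ℚ} {d : ℕ}
    (hE : E.IsHomogeneous d) (hE0 : E ≠ 0) (hd : 1 ≤ d) : ¬ IsUnit E := by
  rintro ⟨u, hu⟩
  have hne : ((u⁻¹ : (MvPolynomial σ ℚ)ˣ) : MvPolynomial σ ℚ) ≠ 0 := Units.ne_zero _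
  have h1 : E * ↑u⁻¹ = 1 := by rw [← hu, Units.mul_inv]
  have h2 := totalDegree_mul_of_isDomain hE0 hne
  rw [h1, totalDegree_one, hE.totalDegree hE0] at h2
  omega

/-! ## Associated primes of a principal ideal and their Hilbert function -/

/-- In the factorial ring `ℚ[x₀, …, x_m]` every associated prime of a principal ideal `(E)`,
`E ≠ 0`, is `(R)` for a prime factor `R` of `E`: it is a colon ideal `((E) : x) = (E / gcd(E, x))`.
[folklore] -/
theorem exists_eq_span_prime_of_mem_associatedPrimes {m : ℕ} {E : Rx m} (hE0 : E ≠ 0)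
    {𝔭 : Ideal (Rx m)} (h𝔭 : 𝔭 ∈ (Ideal.span {E}).associatedPrimes) :
    ∃ R : Rx m, 𝔭 = Ideal.span {R} ∧ R ∣ E ∧ Prime R := by
  classical
  letI : GCDMonoid (Rx m) := UniqueFactorizationMonoid.toGCDMonoid (Rx m)
  obtain ⟨hprime, x, hx⟩ := Submodule.isAssociatedPrime_iff.mp h𝔭
  obtain ⟨E', x', hE, hxx, hunit⟩ := extract_gcd E x
  have hg0 : gcd E x ≠ 0 := fun h => hE0 (by rw [hE, h, zero_mul])
  have hrel : IsRelPrime E' x' := gcd_isUnit_iff_isRelPrime.mp hunit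
  have hcolon : (Ideal.span {E} : Submodule (Rx m) (Rx m)).colon {x} = Ideal.span {E'} :=
    PhilipponMain.colon_span_singleton_eq hE hxx hg0 hrel
  have h𝔭eq : 𝔭 = Ideal.span {E'} := by rw [hx]; exact hcolon
  have hE'0 : E' ≠ 0 := fun h => hE0 (by rw [hE, h, mul_zero])
  have hE'prime : Prime E' := by
    have h := hprime
    rw [h𝔭eq, Ideal.span_singleton_prime hE'0] at h
    exact h
  exact ⟨E', h𝔭eq, ⟨gcd E x, by rw [mul_comm]; exact hE⟩, hE'prime⟩

/-- **Hilbert function of a principal ideal of `ℚ[x₀, x₁]`**: for a non-zero binary form `R` of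
degree `r`, the forms of degree `t + r` in `(R)` are `R · ℚ[x₀, x₁]_t`, a space of dimension
`t + 1` (hypersurface section of the zero ideal by the non-zero-divisor `R`). [folklore] -/
theorem finrank_homogeneousSubmodule_inf_span_singleton {R : Rx 1} {r : ℕ}
    (hR : R.IsHomogeneous r) (hR0 : R ≠ 0) (t : ℕ) :
    Module.finrank ℚ ↥(homogeneousSubmodule (Fin (1 + 1)) ℚ (t + r) ⊓
        (Ideal.span {R}).restrictScalars ℚ) = t + 1 := by
  letI := MvPolynomial.gradedAlgebra (σ := Fin (1 + 1)) (R := ℚ)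
  have h := Literature.RingTheory.MvPolynomial.finrank_idealDegree_sup_span_add_eq
    (I := (⊥ : Ideal (Rx 1))) (Ideal.IsHomogeneous.bot _) hR0 hR
    (fun f hf => by
      rw [Ideal.mem_bot] at hf ⊢
      exact (mul_eq_zero.mp hf).resolve_left hR0) t
  rw [bot_sup_eq, Literature.RingTheory.MvPolynomial.idealDegree_bot,
    Literature.RingTheory.MvPolynomial.idealDegree_bot, finrank_bot, add_zero, zero_add,
    Literature.RingTheory.HilbertSamuel.finrank_homogeneousSubmodule_fin] at h
  rw [inf_comm]
  change Module.finrank ℚ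
    ↥(Literature.RingTheory.MvPolynomial.idealDegree (Ideal.span {R}) (t + r)) = t + 1
  rw [h, show t + (1 + 1) - 1 = t + 1 by omega, Nat.choose_succ_self_right]

/-- **The interpolation clause** for the associated primes of `(E)`, `E` a non-zero binary form of
degree `d ≤ δ`: each is `(R)` for a form `R ∣ E` of degree `r ≤ d`, `deg (R) = r` (LNM 1752 Ch. 3
Prop. 4.8 1)), and `dim ℚ[x₀,x₁]_δ = δ + 1 = dim (R)_δ + r`. [folklore] -/
theorem interpolation_of_mem_associatedPrimes {E : Rx 1} {d : ℕ} (hE : E.IsHomogeneous d)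
    (hE0 : E ≠ 0) {δ : ℕ} (hdδ : d ≤ δ) {𝔭 : Ideal (Rx 1)}
    (h𝔭 : 𝔭 ∈ (Ideal.span {E}).associatedPrimes) :
    Module.finrank ℚ ↥(homogeneousSubmodule (Fin (1 + 1)) ℚ δ) =
      Module.finrank ℚ ↥(homogeneousSubmodule (Fin (1 + 1)) ℚ δ ⊓ 𝔭.restrictScalars ℚ) +
        ideg 𝔭 1 := by
  obtain ⟨R, rfl, hRE, hRp⟩ := exists_eq_span_prime_of_mem_associatedPrimes hE0 h𝔭
  have hR0 : R ≠ 0 := hRp.ne_zero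
  have hRu : ¬ IsUnit R := hRp.not_unit
  have hRhom : R.IsHomogeneous R.totalDegree := Roy2013.isHomogeneous_of_dvd hE hE0 hRE
  -- `deg R ≤ deg E`
  have hrd : R.totalDegree ≤ d := by
    obtain ⟨g, hg⟩ := hRE
    have hg0 : g ≠ 0 := by
      rintro rfl
      exact hE0 (by rw [hg, mul_zero])
    have h := totalDegree_mul_of_isDomain hR0 hg0
    rw [← hg, hE.totalDegree hE0] at h
    omega
  -- `deg (R) = deg R` (Prop. 4.8 1))
  have hunm : IsUnmixedOfRank (Ideal.span {R}) 1 :=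
    PhilipponMain.isUnmixedOfRank_span_singleton hR0 hRu
  have hω : (Fin.cons 1 0 : Fin (1 + 1) → ℂ) ≠ 0 := PhilipponMain.cons_one_ne_zero 0
  obtain ⟨hdeg, -, -⟩ :=
    NesterenkoPhilippon2001_ch3_prop_4_8_holds 1 R R.totalDegree le_rfl hR0 hRhom hunm _ hω
  rw [hdeg]
  obtain ⟨t, rfl⟩ : ∃ t, δ = t + R.totalDegree := ⟨δ - R.totalDegree, by omega⟩
  rw [finrank_homogeneousSubmodule_inf_span_singleton hRhom hR0 t,
    Literature.RingTheory.HilbertSamuel.finrank_homogeneousSubmodule_fin,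
    show t + R.totalDegree + (1 + 1) - 1 = t + R.totalDegree + 1 by omega,
    Nat.choose_succ_self_right]
  ring

/-! ## The accuracy bookkeeping -/

/-- The output-dependent accuracy is paid by Dirichlet's exponent: with `200 ≤ c ≤ Δ ≤ Y`,
`N ≤ Δ ≤ 2N`, `1 ≤ D ≤ N`, `h ≤ Y + D` one has `(Δ h + Y D)/c ≤ 0.455 N Y − 2 D`. [folklore] -/
theorem accuracy_arith {Δ Y c N D h : ℝ} (hc : 200 ≤ c) (hcΔ : c ≤ Δ) (hΔY : Δ ≤ Y) (hN : N ≤ Δ)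
    (hΔN : Δ ≤ 2 * N) (hD1 : 1 ≤ D) (hDN : D ≤ N) (hhY : h ≤ Y + D) :
    -(455 / 1000) * N * Y + 2 * D ≤ -((Δ * h + Y * D) / c) := by
  have hΔ0 : 0 ≤ Δ := by linarith
  have hY0 : 0 ≤ Y := by linarith
  have hN0 : 0 ≤ N := by linarith
  have hc0 : 0 < c := by linarith
  have h1 : Δ * h ≤ Δ * (Y + D) := mul_le_mul_of_nonneg_left hhY hΔ0
  have h2 : Δ * (Y + D) ≤ 2 * N * (Y + D) := mul_le_mul_of_nonneg_right hΔN (by linarith)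
  have h3 : N * D ≤ N * Y := mul_le_mul_of_nonneg_left (by linarith) hN0
  have h4 : Y * D ≤ Y * N := mul_le_mul_of_nonneg_left hDN hY0
  have h5 : N * 200 ≤ N * Y := mul_le_mul_of_nonneg_left (by linarith) hN0
  have h6 : 0 ≤ 455 / 1000 * N * Y - 2 * D := by linarith
  have h7 : (455 / 1000 * N * Y - 2 * D) * 200 ≤ (455 / 1000 * N * Y - 2 * D) * c :=
    mul_le_mul_of_nonneg_left hc h6
  have hkey : (Δ * h + Y * D) / c ≤ 455 / 1000 * N * Y - 2 * D := by
    rw [div_le_iff₀ hc0]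
    linarith
  linarith

end CycleAPIOne

/-! ## The stub -/

/-- **Stub 1a — `CycleAPIAt 1`**: the 0-cycle approximation property with interpolation control
in dimension `1` is Dirichlet's box principle (Bugeaud 2004 Lemma 8.1) read in Nesterenko's
language through the homogenisation of the pigeonhole polynomial and LNM 1752 Ch. 3 Prop. 4.8;
constant `c(ω) = 50 (4 + |ω|)`, degree `⌊Δ⌋`, height `e^{Y}`.
[cite: NesterenkoPhilippon2001, Ch. 4 §4 (p. 61), Ch. 3 Prop. 4.8 (p. 40)] -/
theorem stub_cycleAPI_one : CycleAPIAt 1 := by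
  letI := MvPolynomial.gradedAlgebra (σ := Fin (1 + 1)) (R := ℚ)
  intro ω
  -- the constant
  set ξ : ℂ := ω 0 with hξ
  set A : ℝ := 4 + ‖ξ‖ with hA
  have hA4 : 4 ≤ A := by rw [hA]; linarith [norm_nonneg ξ]
  have hA0 : 0 < A := by linarith
  refine ⟨50 * A, by linarith, fun Δ Y hΔ hY => ?_⟩
  set c : ℝ := 50 * A with hc
  have hc200 : 200 ≤ c := by linarith
  have hc0 : 0 < c := by linarith
  have hΔ0 : 0 ≤ Δ := by linarith
  have hYc : c ≤ Y := hΔ.trans hY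
  have hY0 : 0 ≤ Y := by linarith
  -- the degree `n = ⌊Δ⌋ ≥ 50`
  set n : ℕ := ⌊Δ⌋₊ with hn
  have hn50 : 50 ≤ n := Nat.le_floor (by push_cast; linarith)
  have hnR : (50 : ℝ) ≤ n := by exact_mod_cast hn50
  have hnΔ : (n : ℝ) ≤ Δ := Nat.floor_le hΔ0
  have hΔn : Δ ≤ 2 * n := by
    have h1 : Δ < n + 1 := Nat.lt_floor_add_one Δ
    linarith
  have hnY : (n : ℝ) ≤ Y := hnΔ.trans hY
  -- the height `H = e^Y ≥ (4 + |ξ|)^50`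
  set H : ℝ := Real.exp Y with hH
  have hlogH : Real.log H = Y := Real.log_exp Y
  have hAH : A ^ 50 ≤ H := by
    rw [← Real.exp_log (pow_pos hA0 50), Real.log_pow, hH, Real.exp_le_exp]
    have := Real.log_le_sub_one_of_pos hA0
    push_cast
    nlinarith
  -- Dirichlet's box principle
  obtain ⟨P, hP0, hPn, hPH, hPξ⟩ :=
    Literature.NumberTheory.DiophantineApproximation.exists_int_poly_small_value ξ n hn50 H hAH
  rw [hlogH] at hPξ
  have hsmall : Real.exp (-(455 / 1000) * n * Y) < 1 := by
    rw [Real.exp_lt_one_iff]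
    nlinarith
  -- `P` is not constant
  have hd1 : 1 ≤ P.natDegree := by
    by_contra hlt
    obtain ⟨a, ha⟩ := Polynomial.natDegree_eq_zero.mp (by omega : P.natDegree = 0)
    have ha0 : a ≠ 0 := by
      rintro rfl
      exact hP0 (by rw [← ha, map_zero])
    have h1 : (1 : ℝ) ≤ ‖(Polynomial.aeval ξ P : ℂ)‖ := by
      rw [← ha, Polynomial.aeval_C, algebraMap_int_eq, eq_intCast, Complex.norm_intCast]
      exact_mod_cast Int.one_le_abs ha0
    linarith
  have hdn : (P.natDegree : ℝ) ≤ n := by exact_mod_cast hPn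
  -- homogenisation and the principal ideal `(E)`
  obtain ⟨E, hE0, hEhom, hEval, hE1, hEH, hEht⟩ := CycleAPIOne.exists_binary_form P hP0 hPH
  have hω0 : (Fin.cons 1 ω : Fin (1 + 1) → ℂ) ≠ 0 := PhilipponMain.cons_one_ne_zero ω
  have hω1 : 1 ≤ ‖(Fin.cons 1 ω : Fin (1 + 1) → ℂ)‖ := PhilipponMain.one_le_norm_cons_one ω
  have hEu : ¬ IsUnit E := CycleAPIOne.not_isUnit_of_isHomogeneous hEhom hE0 hd1
  have hunm : IsUnmixedOfRank (Ideal.span {E}) 1 :=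
    PhilipponMain.isUnmixedOfRank_span_singleton hE0 hEu
  obtain ⟨hdeg, hht, habs⟩ :=
    NesterenkoPhilippon2001_ch3_prop_4_8_holds 1 E P.natDegree le_rfl hE0 hEhom hunm _ hω0
  -- the height of `E`
  have hhtE : height E ≤ Y := by
    refine hEht.trans ?_
    rw [← hlogH]
    exact Real.log_le_log (by linarith) hEH
  have hihY : iheight (Ideal.span {E}) 1 ≤ Y + P.natDegree := by
    refine hht.trans ?_
    norm_num
    exact hhtE
  -- the normalised value of `E` at `(1, ω)`
  have hnorm : normAt (Fin.cons 1 ω) E ≤ Real.exp (-(455 / 1000) * n * Y) := by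
    rw [normAt, hEval ω]
    refine (div_le_self (norm_nonneg _) ?_).trans hPξ
    exact one_le_mul_of_one_le_of_one_le hE1 (one_le_pow₀ hω1)
  refine ⟨Ideal.span {E}, ?_, hunm, ?_, ?_, ?_, ?_⟩
  · -- homogeneity
    refine Ideal.homogeneous_span _ _ fun x hx => ?_
    rw [Set.mem_singleton_iff] at hx
    subst hx
    exact ⟨P.natDegree, hEhom⟩
  · -- degree budget: `deg I = deg P ≤ ⌊Δ⌋ ≤ Δ ≤ cΔ`
    rw [hdeg, pow_one]
    have : Δ ≤ c * Δ := le_mul_of_one_le_left hΔ0 (by linarith)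
    linarith
  · -- height budget: `h(I) ≤ Y + deg P ≤ 2Y ≤ cY`
    rw [Nat.sub_self, pow_zero, mul_one]
    nlinarith
  · -- accuracy: `|I(1, ω)| ≤ |P(ω)| e^{2 deg P} ≤ e^{-0.455 n Y + 2 deg P}`
    --           `≤ e^{-(Δ h(I) + Y deg I)/c}`
    rw [hdeg]
    calc iabs (Ideal.span {E}) 1 (Fin.cons 1 ω)
        ≤ normAt (Fin.cons 1 ω) E * Real.exp (2 * (1 : ℕ) ^ 2 * P.natDegree) := by
          exact_mod_cast habs
      _ ≤ Real.exp (-(455 / 1000) * n * Y) * Real.exp (2 * (1 : ℕ) ^ 2 * P.natDegree) := by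
          gcongr
      _ = Real.exp (-(455 / 1000) * n * Y + 2 * P.natDegree) := by
          rw [← Real.exp_add]; norm_num
      _ ≤ Real.exp (-((Δ * iheight (Ideal.span {E}) 1 + Y * (P.natDegree : ℝ)) / c)) := by
          rw [Real.exp_le_exp]
          exact CycleAPIOne.accuracy_arith hc200 hΔ hY hnΔ hΔn (by exact_mod_cast hd1) hdn hihY
  · -- interpolation clause
    intro 𝔭 h𝔭
    have hdδ : P.natDegree ≤ ⌊c * Δ⌋₊ :=
      hPn.trans (Nat.floor_le_floor (le_mul_of_one_le_left hΔ0 (by linarith)))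
    exact CycleAPIOne.interpolation_of_mem_associatedPrimes hEhom hE0 hdδ h𝔭

end Summit.Schanuel.Schanuel.Cruxes.ApproximationProperty.OrbitInterpolationDeterminant

end
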